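import Mathlib
import Summits.HodgeConjecture.HodgeConjecture.Theorems.HodgeLocusCensusKroneckerProfile

/-!
# Hodge-locus census — THE RANK LADDER (THEOREM SPEC-2): `ρ = rank(×g : B_2 → B_{e+2})` takes only four values
(def-free, computable helper of `stmt-HodgeConjecture-16267`; pub-hlocus, seat ivhs-2 = ENGINE B, gen 32; record
`pub-hlocus-ivhs-2/ENGINEB-g32.md` §1–§3; companion of `HodgeLocusCensusKroneckerProfile.lean` (THEOREM K⁼: `b = H_B(t-d) - ρ`),
whose closed forms `b`, `hmin` and `ConnectedSum.e = H_B(t-d)` it reuses.)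

Setting (record §1).  `K` a field of characteristic `0`, `k ≥ 2`, `e ≥ 3`, `B = K[x_1, …, x_k]/(x_1^{e+1}, …, x_k^{e+1})`; for
`g ∈ B_e` put `N_g = ker(×g : B_2 → B_{e+2})`, `ρ(g) = C(k+1,2) - dim N_g`.  In the census (c′ = 1 cells `(2k′, d, k′-1)`):
`k = k′`, `e = d - 2`, `g = δ = F_{ab}|_𝕃`, and THEOREM K⁼ gives the jump `b(X) = H_B(2) - ρ(δ)`.
THEOREM SPEC-2 (paper proof in the record, §1): `dim N_g ∈ {0, 1, k, C(k+1,2)}`, i.e. `ρ ∈ {C(k+1,2), C(k+1,2)-1, C(k,2), 0}`, and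
`dim N_g = k` iff a linear form kills `g` iff `g = c·x_i^e` or `g = c·H_τ`, `H_τ = Σ_{m ≤ e} τ^m x_i^m x_j^{e-m}` (`c, τ ≠ 0`).
COROLLARY SPEC (record §3): the `b`-spectrum of every c′ = 1 cell with `k′ ≥ 3`, `d ≥ 5` is exactly `{H_B(2), k′, 1, 0}`.

KERNEL-CHECKED HERE (the paper steps they feed are named):
* step (a) of the proof — the MONOMIAL TABLE `dim N_{x^α} = k / 1 / 0` according as `α = e·e_i` / `max α = e-1` / `max α ≤ e-2`:
  `monomial_table` (every monomial of degree `e` on the grid `k ∈ {2,3,4}`, `e ∈ {3,4,5}`, and `(k,e) = (5,3)`, by `decide`; `dim N_{x^α}`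
  is the number `nKer` of quadric monomials `x^β` with `x^{α+β} = 0`, the kernel of a monomial map being spanned by the killed monomials),
  `monomial_values` (the values are in `{k, 1, 0}`), the two symbolic shape lemmas behind the table for ALL `k, e` — `overflow_shape`
  (an overflow `α_i + β_i ≥ e+1` with `|β| = 2` has `β_i = 2, α_i ≥ e-1` or `β_i = 1, α_i = e`) and `at_most_one_big` (for `e ≥ 3` a
  degree-`e` exponent vector has at most one entry `≥ e-1`) — and `e_two_exception` (`e = 2` is genuinely different: `x₁x₂` kills two quadrics);
* step (c) — the GEOMETRIC KILL identity `(x_j - τx_i)·H_τ = x_j^{e+1} - τ^{e+1}x_i^{e+1}` in every commutative ring, all `e` (`geometric_kill`,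
  from Mathlib's `geom_sum₂_mul`), hence `= 0` wherever `x_i^{e+1} = x_j^{e+1} = 0` (`geometric_kill_zero`): the linear form `x_j - τx_i` kills `H_τ` in `B`;
* STEP 4 of the Ternary Lemma — `C(e,1)² ≠ C(e,0)·C(e,2)` for every `e ≥ 1` (`choose_not_geometric`, and its cast to `ℚ`): the coefficients of
  `(λ₁x + λ₂y)^e` are never a geometric progression in characteristic `0`;
* the LADDER ARITHMETIC — `b = H_B(2) - ρ` maps the `ρ`-ladder `[C(k+1,2), C(k+1,2)-1, C(k,2), 0]` onto `[0, 1, k, C(k+1,2)]` for every `k ≥ 1`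
  (`bLadder_eq`, via Pascal `(k+1).choose 2 = k + k.choose 2`), and, on the closed forms of anchors 1–2, `H_B(t-d) = H_min = C(k′+1,2)` and
  `b k′ d k′ ρ` over the ladder `= [0, 1, k′, C(k′+1,2)]` for `k′ ∈ {3,4,5}`, `d ∈ {5,…,9}` (`c1_cells_e_hmin`, `bSpectrum_table`, by `decide`).
NOT kernel-checked (paper, record §1): the weight-degeneration inequality (b), the Hankel rank-one argument of (c), STEPS 1–3 of the
Ternary Lemma (d); the record's §2 cross-checks them on two disjoint exact code paths (31428 forms, no rank outside the ladder).

certified instances and evidence bearing on the general Hodge conjecture; no claim.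
-/

set_option maxRecDepth 200000
set_option maxHeartbeats 8000000

namespace Summit.HodgeConjecture.HodgeConjecture.HodgeLocus.Census.RankLadder

open Finset

/-- all exponent vectors of length `k` with entries `≤ M` and sum `n` -/
def vecs : ℕ → ℕ → ℕ → List (List ℕ)
  | 0, _, n => if n = 0 then [[]] else []
  | k + 1, M, n => (List.range (min M n + 1)).flatMap fun x => (vecs k M (n - x)).map (List.cons x)

/-- `x^α · x^β = 0` in `B = K[x_1..x_k]/(x_i^{e+1})` iff some exponent of `α + β` is `≥ e+1` -/
def killed (e : ℕ) (α β : List ℕ) : Bool :=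
  (List.zipWith (· + ·) α β).any fun s => decide (e + 1 ≤ s)

/-- `dim N_{x^α}` = the number of quadric monomials `x^β` (`|β| = 2`, entries `≤ 2 < e+1`) with `x^{α+β} = 0` in `B` -/
def nKer (e : ℕ) (α : List ℕ) : ℕ :=
  ((vecs α.length 2 2).filter (killed e α)).length

/-- the rule of step (a): `k` if some `α_i = e` (i.e. `α = e·e_i`), `1` if some `α_i = e-1` (then `max α = e-1`), else `0` -/
def rule (e : ℕ) (α : List ℕ) : ℕ :=
  if α.any (fun x => decide (x = e)) then α.length
  else if α.any (fun x => decide (x + 1 = e)) then 1 else 0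

/-- sizes of the bases used: `dim B_2 = C(k+1,2)` and `dim B_e` -/
theorem vecs_sizes :
    (vecs 2 2 2).length = 3 ∧ (vecs 3 2 2).length = 6 ∧ (vecs 4 2 2).length = 10 ∧ (vecs 5 2 2).length = 15 ∧
    (vecs 3 3 3).length = 10 ∧ (vecs 3 4 4).length = 15 ∧ (vecs 3 5 5).length = 21 ∧ (vecs 4 3 3).length = 20 ∧
    (vecs 4 4 4).length = 35 ∧ (vecs 5 3 3).length = 35 := by
  decide

/-- STEP (a), THE MONOMIAL TABLE: `dim N_{x^α}` follows the `k / 1 / 0` rule for every monomial of degree `e`,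
`k ∈ {2,3,4}`, `e ∈ {3,4,5}` (the record's §2 (C1) grid, there checked on two exact code paths). -/
theorem monomial_table : ∀ k ∈ [2, 3, 4], ∀ e ∈ [3, 4, 5], ∀ α ∈ vecs k e e, nKer e α = rule e α := by
  decide

/-- the same for `(k, e) = (5, 3)` (35 monomials) -/
theorem monomial_table_5_3 : ∀ α ∈ vecs 5 3 3, nKer 3 α = rule 3 α := by
  decide

/-- hence the only values of `dim N_{x^α}` are `k, 1, 0` -/
theorem monomial_values : ∀ k ∈ [2, 3, 4], ∀ e ∈ [3, 4, 5], ∀ α ∈ vecs k e e, nKer e α = k ∨ nKer e α = 1 ∨ nKer e α = 0 := by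
  decide

/-- `e = 2` is genuinely different (the theorem needs `e ≥ 3`, i.e. `d ≥ 5`): in `K[x₁,x₂,x₃]/(x_i³)` the monomial `x₁x₂` kills the
two quadrics `x₁², x₂²`, a value outside `{k, 1, 0} = {3, 1, 0}`; the record's example `ρ(x₁x₂) = 4` for `(k′, d) = (3, 4)`. -/
theorem e_two_exception : nKer 2 [1, 1, 0] = 2 ∧ rule 2 [1, 1, 0] = 1 ∧ (vecs 3 2 2).filter (killed 2 [1, 1, 0]) = [[0, 2, 0], [2, 0, 0]] := by
  decide

/-- (A1) symbolic shape lemma behind the table, all `e`: an overflow `α_i + β_i ≥ e+1` with `α_i ≤ e` and `β_i ≤ 2` (a quadric exponent)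
is either `β_i = 2` over an `α_i ≥ e-1`, or `β_i = 1` over `α_i = e`. -/
theorem overflow_shape (e αi βi : ℕ) (hα : αi ≤ e) (hβ : βi ≤ 2) (h : e + 1 ≤ αi + βi) :
    (βi = 2 ∧ e - 1 ≤ αi) ∨ (βi = 1 ∧ αi = e) := by
  omega

/-- (A2) symbolic shape lemma, all `e ≥ 3`: a degree-`e` exponent vector cannot have two entries `≥ e-1`
(this is exactly where `e ≥ 3` is used: `2(e-1) > e`). -/
theorem at_most_one_big (e : ℕ) (he : 3 ≤ e) (as bs cs : List ℕ) (x y : ℕ)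
    (hsum : (as ++ x :: bs ++ y :: cs).sum = e) (hx : e - 1 ≤ x) (hy : e - 1 ≤ y) : False := by
  simp only [List.sum_append, List.sum_cons, List.append_assoc, List.cons_append] at hsum
  omega

/-- STEP (c), THE GEOMETRIC KILL IDENTITY, every commutative ring and every `e`:
`(x_j - τ x_i) · Σ_{m ≤ e} (τ x_i)^m x_j^{e-m} = x_j^{e+1} - τ^{e+1} x_i^{e+1}`. -/
theorem geometric_kill {R : Type*} [CommRing R] (τ xi xj : R) (e : ℕ) :
    (xj - τ * xi) * (∑ m ∈ range (e + 1), (τ * xi) ^ m * xj ^ (e - m)) = xj ^ (e + 1) - τ ^ (e + 1) * xi ^ (e + 1) := by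
  have h := geom_sum₂_mul (τ * xi) xj (e + 1)
  simp only [Nat.add_sub_cancel] at h
  linear_combination (-1 : R) * h

/-- hence in `B` (where `x_i^{e+1} = x_j^{e+1} = 0`) the linear form `x_j - τ x_i` kills the geometric binary form `H_τ`:
`dim N_{H_τ} ≥ k`, the third rung of the ladder (record §1 (c), (iii) ⟹ (ii)). -/
theorem geometric_kill_zero {R : Type*} [CommRing R] (τ xi xj : R) (e : ℕ) (hi : xi ^ (e + 1) = 0) (hj : xj ^ (e + 1) = 0) :
    (xj - τ * xi) * (∑ m ∈ range (e + 1), (τ * xi) ^ m * xj ^ (e - m)) = 0 := by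
  rw [geometric_kill, hi, hj]; ring

/-- STEP 4 of the Ternary Lemma: `C(e,0), C(e,1), C(e,2)` are never in geometric progression (`e ≥ 1`), i.e. the coefficients of a
binomial expansion `(λ₁x + λ₂y)^e`, `λ₁λ₂ ≠ 0`, are not a geometric progression. -/
theorem choose_not_geometric (e : ℕ) (he : 1 ≤ e) : (e.choose 1) ^ 2 ≠ e.choose 0 * e.choose 2 := by
  rw [Nat.choose_one_right, Nat.choose_zero_right, Nat.choose_two_right, one_mul, sq]
  intro h
  have h1 : e * (e - 1) / 2 ≤ e * (e - 1) := Nat.div_le_self _ _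
  have h2 : e * (e - 1) < e * e := Nat.mul_lt_mul_of_pos_left (by omega) (by omega)
  omega

/-- the same inequality read in a field of characteristic `0` (here `ℚ`), as STEP 4 uses it -/
theorem choose_not_geometric_rat (e : ℕ) (he : 1 ≤ e) : ((e.choose 1 : ℕ) : ℚ) ^ 2 ≠ (e.choose 0 : ℚ) * (e.choose 2 : ℚ) := by
  exact_mod_cast choose_not_geometric e he

/-- the four values of `ρ = rank(×g : B_2 → B_{e+2})` allowed by THEOREM SPEC-2 (`k` variables) -/
def rhoLadder (k : ℕ) : List ℕ := [(k + 1).choose 2, (k + 1).choose 2 - 1, k.choose 2, 0]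

/-- the corresponding values of the jump `b = H_B(2) - ρ` -/
def bLadder (k : ℕ) : List ℕ := [0, 1, k, (k + 1).choose 2]

/-- LADDER ARITHMETIC, every `k ≥ 1`: `ρ ↦ C(k+1,2) - ρ` maps the `ρ`-ladder onto `[0, 1, k, C(k+1,2)]`
(Pascal: `C(k+1,2) = k + C(k,2)`, so `H_B(2) - C(k,2) = k`). -/
theorem bLadder_eq (k : ℕ) (hk : 1 ≤ k) : (rhoLadder k).map (fun ρ => (k + 1).choose 2 - ρ) = bLadder k := by
  have pascal : (k + 1).choose 2 = k + k.choose 2 := by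
    rw [Nat.choose_succ_succ, Nat.choose_one_right]
  simp only [rhoLadder, bLadder, List.map_cons, List.map_nil, pascal, List.cons.injEq, and_true]
  omega

/-- CENSUS TIE (closed forms of anchors 1–2, c′ = 1 cells are `(p, d, c) = (k′, d, k′)`): for `k′ ∈ {3,4,5}` and `d ∈ {5,…,9}`,
`H_B(t-d) = C(k′+1,2) = H_B(2)` and `H_min = C(k′+1,2)` (so all four rungs are `≤ H_min`). -/
theorem c1_cells_e_hmin : ∀ k ∈ [3, 4, 5], ∀ d ∈ [5, 6, 7, 8, 9],
    ConnectedSum.e k d k = (k + 1).choose 2 ∧ KroneckerProfile.hmin k d k = (k + 1).choose 2 := by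
  decide

/-- COROLLARY SPEC, enumerated on the census closed forms: in the c′ = 1 cells with `k′ ∈ {3,4,5}`, `d ∈ {5,…,9}` the jump
`b = H_B(t-d) - ρ` of THEOREM K⁼ (anchor 2's `b p d c ρ`) over the `ρ`-ladder is exactly `[0, 1, k′, C(k′+1,2)]`
(`(6,d,2)`: `{0,1,3,6}`; `(8,d,3)`: `{0,1,4,10}`; `(10,d,4)`: `{0,1,5,15}`). -/
theorem bSpectrum_table : ∀ k ∈ [3, 4, 5], ∀ d ∈ [5, 6, 7, 8, 9],
    (rhoLadder k).map (KroneckerProfile.b k d k) = bLadder k := by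
  decide

end Summit.HodgeConjecture.HodgeConjecture.HodgeLocus.Census.RankLadder
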